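/-
Copyright (c) 2026. All rights reserved.
Released under Apache 2.0 license as described in the file LICENSE.
Authors: abc-iut cell — seat abc-iut-f-104 (F fact-proving wave, tranche 104: FACT-LIST row F-0182
`PanalocalizationExists` of `PanalocalTheaters.lean`), gen 3.
-/
import Literature.AnabelianGeometry.AbsoluteAnabelian.GaloisTheatersNumberFieldShadowDecomposition
import HarnessLib

/-!
# [AbsTopIII] Def 5.1 (ii)/(iv) at the number-field SHADOW: the structural hypotheses (S⊚), (S⊚′), (S_arc), (S_non) of the
# panalocalization hold for `V⊚(Π_E)` at every admissible `Π_E`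

S. Mochizuki, *Topics in absolute anabelian geometry III* [MochizukiAbsTopIII2015], Def 5.1 (ii) p. 114, (iv) p. 116, Cor 5.2 (v)
p. 120.

PROOF-ONLY companion (no `def` / `structure` / `instance`) of abc-iut-L4-d2's `GaloisTheatersNumberFieldShadow.lean`, sequel to
`GaloisTheatersNumberFieldShadowDecomposition.lean` (F-0181 side).  The F-0182 structural instance form
`panalocalizationExists_of_decompositionStructure` (p437068; and the F-0183 form `panalocalizationMapsHom_of_decompositionStructure`,
p438174) take, at each admissible `E` of a context `R`, the hypotheses
(S⊚) `(R.proVal E).decomp ṽ = ⊤ → ṽ = ⊚`, (S⊚′) `IsOpen (R.proVal E).decomp ṽ → ṽ = ⊚`, (S_arc) `R.galDecomp E ṽ` finite for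
archimedean `ṽ`, (S_non) `R.galDecomp E ṽ` infinite for nonarchimedean `ṽ`, where `R.galDecomp E ṽ = ((R.proVal E).decomp ṽ).map E.aug`.
For the eventual shadow context (`R.proVal := shadowProVal F`, L4-d2, conditional on the Neukirch–Uchida fact) THIS FILE PROVES ALL
FOUR at `shadowProVal F E` for every admissible `E`, unconditionally, by transporting the genuine-pro-set theorems of
`NumberFieldValuationProSetDecomposition.lean` / `PanalocalTheatersStructural.lean` §4 along the admissibility isomorphism
`shadowHom F E : Π_E ≃ G_F` and the bijection `aug : Π_E → G_E` (`Δ = 1`):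

* `decomp_shadowProVal_eq_top_iff`, `isOpen_decomp_shadowProVal_iff`, `finite_map_aug_decomp_shadowProVal_iff` (transport);
* **`eq_generic_of_decomp_shadowProVal_eq_top`** (S⊚), **`eq_generic_of_isOpen_decomp_shadowProVal`** (S⊚′),
  **`finite_galDecomp_shadowProVal_of_mem_arc`** (S_arc), **`infinite_galDecomp_shadowProVal_of_mem_non`** (S_non).

HONEST LABEL: shadow ≠ print's `Π_X`; the shadow CONTEXT term is not assembled here (L4-d2), so F-0182 is not discharged at the
intended model by this file alone; classical; nothing here bears on, and no side is taken on, [IUTchIII] Cor. 3.12; typed ≠ proved.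
-/

set_option autoImplicit false

noncomputable section

open scoped NumberField Pointwise
open CategoryTheory Topology Field

namespace Literature.AnabelianGeometry.AbsoluteAnabelian

namespace NumberFieldShadow

variable (F : Type) [Field F] [NumberField F]

/-! ### Transport along the admissibility isomorphism -/

/-- `Π_{E,ṽ} = Π_E ↔ (G_F)_ṽ = G_F` at an admissible `E` (`shadowHom` is an isomorphism).
[cite: MochizukiAbsTopIII2015, Def 5.1 (iii) p.115] -/
theorem decomp_shadowProVal_eq_top_iff {E : FundamentalExtension.{0}} (hE : IsAdmissible F E)
    (v : (shadowProVal F E).carrier) :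
    (shadowProVal F E).decomp v = ⊤ ↔ (NumberField.valuationProSet F).decomp v = ⊤ := by
  set ψ := AbsTopI.isoArith (Classical.choice hE) with hψ
  have hmem : ∀ g : E.arith,
      g ∈ (shadowProVal F E).decomp v ↔ ψ g ∈ (NumberField.valuationProSet F).decomp v := fun g => by
    rw [mem_decomp_shadowProVal_iff, congrFun (coe_shadowHom_of_isAdmissible F hE) g]
    exact Iff.rfl
  simp only [Subgroup.eq_top_iff']
  constructor
  · intro h y
    have := (hmem (ψ.symm y)).mp (h _)
    rwa [ψ.apply_symm_apply] at this
  · intro h g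
    exact (hmem g).mpr (h _)

/-- `Π_{E,ṽ}` is open in `Π_E` iff `(G_F)_ṽ` is open in `G_F`, at an admissible `E` (`shadowHom` is a homeomorphism).
[cite: MochizukiAbsTopIII2015, Def 5.1 (iii) p.115] -/
theorem isOpen_decomp_shadowProVal_iff {E : FundamentalExtension.{0}} (hE : IsAdmissible F E)
    (v : (shadowProVal F E).carrier) :
    IsOpen ((shadowProVal F E).decomp v : Set E.arith) ↔
      IsOpen ((NumberField.valuationProSet F).decomp v : Set (absoluteGaloisGroup F)) := by
  set ψ := AbsTopI.isoArith (Classical.choice hE) with hψ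
  have hset : ((shadowProVal F E).decomp v : Set E.arith) =
      ψ ⁻¹' ((NumberField.valuationProSet F).decomp v : Set (absoluteGaloisGroup F)) := by
    ext g
    rw [SetLike.mem_coe, mem_decomp_shadowProVal_iff, congrFun (coe_shadowHom_of_isAdmissible F hE) g]
    exact Iff.rfl
  rw [hset]
  exact ψ.toHomeomorph.isOpen_preimage

/-- `aug(Π_{E,ṽ}) ⊆ G_E` is finite iff `(G_F)_ṽ` is finite, at an admissible `E` (both `Π_{E,ṽ} ≃ (G_F)_ṽ` and `Π_{E,ṽ} ≃ aug(Π_{E,ṽ})`).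
[cite: MochizukiAbsTopIII2015, Def 5.1 (iii) p.115] -/
theorem finite_map_aug_decomp_shadowProVal_iff {E : FundamentalExtension.{0}} (hE : IsAdmissible F E)
    (v : (shadowProVal F E).carrier) :
    ((((shadowProVal F E).decomp v).map E.aug.toMonoidHom : Subgroup E.gal) : Set E.gal).Finite ↔
      ((NumberField.valuationProSet F).decomp v : Set (absoluteGaloisGroup F)).Finite := by
  obtain ⟨e₁⟩ := nonempty_continuousMulEquiv_decomp_shadowProVal F hE v
  obtain ⟨e₂⟩ := nonempty_continuousMulEquiv_map_aug F hE ((shadowProVal F E).decomp v)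
    ((shadowProVal F E).isClosed_decomp v)
  rw [← Set.finite_coe_iff, ← Set.finite_coe_iff]
  exact (Equiv.finite_iff (e₂.symm.toEquiv.trans e₁.toEquiv))

/-! ### The four structural hypotheses at `shadowProVal F E` -/

/-- **(S⊚) at the shadow**: at an admissible `E`, the only element of `V⊚(Π_E)` fixed by all of `Π_E` is `⊚`
(`NumberFieldValuationProSet.eq_generic_of_decomp_eq_top` transported). [cite: MochizukiAbsTopIII2015, Def 5.1 (ii) p.114] -/
theorem eq_generic_of_decomp_shadowProVal_eq_top {E : FundamentalExtension.{0}} (hE : IsAdmissible F E)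
    (v : (shadowProVal F E).carrier) (h : (shadowProVal F E).decomp v = ⊤) : v = (shadowProVal F E).generic :=
  NumberFieldValuationProSet.eq_generic_of_decomp_eq_top F v ((decomp_shadowProVal_eq_top_iff F hE v).mp h)

/-- **(S⊚′) at the shadow**: at an admissible `E`, the only element of `V⊚(Π_E)` with OPEN decomposition group is `⊚`.
[cite: MochizukiAbsTopIII2015, Def 5.1 (ii) p.114] -/
theorem eq_generic_of_isOpen_decomp_shadowProVal {E : FundamentalExtension.{0}} (hE : IsAdmissible F E)
    (v : (shadowProVal F E).carrier) (h : IsOpen ((shadowProVal F E).decomp v : Set E.arith)) :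
    v = (shadowProVal F E).generic :=
  NumberFieldValuationProSet.eq_generic_of_isOpen_decomp F v ((isOpen_decomp_shadowProVal_iff F hE v).mp h)

/-- **(S_arc) at the shadow**: at an admissible `E`, `G_ṽ = aug(Π_{E,ṽ})` is FINITE for archimedean `ṽ` (order `≤ 2`).
[cite: MochizukiAbsTopIII2015, Def 5.1 (iii) p.115] -/
theorem finite_galDecomp_shadowProVal_of_mem_arc {E : FundamentalExtension.{0}} (hE : IsAdmissible F E)
    (v : (shadowProVal F E).carrier) (hv : v ∈ (shadowProVal F E).arc) :
    ((((shadowProVal F E).decomp v).map E.aug.toMonoidHom : Subgroup E.gal) : Set E.gal).Finite :=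
  (finite_map_aug_decomp_shadowProVal_iff F hE v).mpr (NumberFieldValuationProSet.finite_decomp_of_mem_arc F v hv)

/-- **(S_non) at the shadow**: at an admissible `E`, `G_ṽ = aug(Π_{E,ṽ})` is INFINITE for nonarchimedean `ṽ`
(`≅ Gal(F̄_v/F_v)`). [cite: MochizukiAbsTopIII2015, Def 5.1 (iii) p.115] -/
theorem infinite_galDecomp_shadowProVal_of_mem_non {E : FundamentalExtension.{0}} (hE : IsAdmissible F E)
    (v : (shadowProVal F E).carrier) (hv : v ∈ (shadowProVal F E).non) :
    ((((shadowProVal F E).decomp v).map E.aug.toMonoidHom : Subgroup E.gal) : Set E.gal).Infinite := fun h =>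
  NumberFieldValuationProSet.infinite_decomp_of_mem_non F v hv ((finite_map_aug_decomp_shadowProVal_iff F hE v).mp h)

end NumberFieldShadow

end Literature.AnabelianGeometry.AbsoluteAnabelian

end
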